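import Summits.HubbardSuperconductivity.HubbardLadder.R3R4SoundMultiplet
import Literature.MathematicalPhysics.QuantumLattice.FrameComplementCertificateSigma
import HarnessLib

/-!
# EDSectorGlue — from exact block certificates in the orbit-sum frame to the `complement` field (T7.3)

HONEST FRAMING (page 1): ladder R1–R4 with certified numbers; no claim on H/H₀. This file is the LAST
link of the kernel-checked soundness chain of the E-D-2″ exact-diagonalisation certificate
(`pub-hubbard-r3/EFFICIENCY-ED2p.md` §A, `R4-MEMO.md` §7): it turns a family of per-symmetry-block real
certificates, stated in the (orthogonal, unnormalised) orbit-sum frame `Φ` of the `(N, S^z = 0)` sector,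
into the field
`complement : ∀ v ∈ szSector N 0, (∀ i, ⟨φ_i, v⟩ = 0) → ‖v‖ = 1 → β ≤ Re⟨v, H v⟩`
of `ResidualComplementMultipletData` (`R3R4SoundMultiplet.lean`), with NO loss: the constraint vectors are
the exact frame coordinates `c_j = Φᴴ φ_j` of the certified multiplet (Route 2 of the r3 design: the
rank-`k` modification `Σ_j t_j c_j c_jᵀ` is added to the whole block pencil, so no eigenvector enclosure /
Davis–Kahan step is needed).
What is NOT here: the certificates themselves. Per block `b` the hypothesis `cert.blk b` is discharged by
ONE explicit finite positive-semidefiniteness fact checked in exact arithmetic by the (post-numerics-gate)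
campaign and composed in Lean from
`Literature.Analysis.OperatorTheory.fromBlocks_dotProduct_nonneg_of_pencil_chebyshev_cert` (polynomial
filter, `SchurComplementPencilBound`) or `…_of_residual_cert` (approximate inverse, `SchurComplementResidualBound`),
the free-block corner constant `EDCornerBound.edCornerBoundTT'_holds` transported by
`TempleKato.frame_form_ge_of_support_bound`, and `TempleKato.form_ge_on_ker_of_rank_modified_fromBlocks`.
No certificate exists today; nothing in this file is numerical evidence for R3.
-/

noncomputable section

namespace Summit.HubbardSuperconductivity.HubbardLadder

open Matrix Literature.MathematicalPhysics.QuantumLattice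
  Literature.MathematicalPhysics.QuantumLattice.TempleKato
open scoped ComplexOrder

/-- **E-D-2″ sector certificate data in a block-ordered real frame** for the Hamiltonian `H` on the
`L × L` torus, sector `(N, S^z = 0)`, complement level `β`, and a multiplet `φ` of size `m`:
a frame `Φ` indexed by `(b : B) × (F b ⊕ P b)` (symmetry block `b`; free / pinned orbit sums) spanning the
sector, its REAL compression `M` and Gram matrix `G`, block-diagonal; the exact constraint vectors
`c_j = Φᴴ φ_j`, each supported in one block; and, per block, the certified form inequality
`β G_b ≤ M_b` on `{c_{j,b} ⬝ w = 0}`. [folklore] -/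
structure EDSectorBlockCert (L : ℕ) [NeZero L]
    (H : Matrix (Finset (Orb (FermionTorus 2 L))) (Finset (Orb (FermionTorus 2 L))) ℂ) (N : ℕ) (β : ℝ)
    {m : ℕ} (φ : Fin m → Fock (Orb (FermionTorus 2 L)))
    (B : Type) [Fintype B] [DecidableEq B] (F P : B → Type) [∀ b, Fintype (F b)]
    [∀ b, Fintype (P b)] where
  /-- the frame (columns = orbit sums, ordered by block) -/
  Φ : Matrix (Finset (Orb (FermionTorus 2 L))) ((b : B) × (F b ⊕ P b)) ℂ
  /-- the frame spans the sector -/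
  spans : ∀ v ∈ szSector (Λ := FermionTorus 2 L) N 0, ∃ y : ((b : B) × (F b ⊕ P b)) → ℂ, Φ *ᵥ y = v
  /-- real compression and Gram matrix -/
  M : Matrix ((b : B) × (F b ⊕ P b)) ((b : B) × (F b ⊕ P b)) ℝ
  G : Matrix ((b : B) × (F b ⊕ P b)) ((b : B) × (F b ⊕ P b)) ℝ
  hM : Φᴴ * H * Φ = M.map ((↑) : ℝ → ℂ)
  hG : Φᴴ * Φ = G.map ((↑) : ℝ → ℂ)
  M_blk : ∀ a a', a.1 ≠ a'.1 → M a a' = 0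
  G_blk : ∀ a a', a.1 ≠ a'.1 → G a a' = 0
  /-- exact constraint vectors `c_j = Φᴴ φ_j`, block-local -/
  c : Fin m → ((b : B) × (F b ⊕ P b)) → ℝ
  hc : ∀ j, Φᴴ *ᵥ φ j = fun a => (c j a : ℂ)
  c_blk : ∀ j, ∃ b, ∀ a, a.1 ≠ b → c j a = 0
  /-- the per-block certificates (the campaign's exact-arithmetic facts, composed in Lean) -/
  blk : ∀ (b : B) (x : F b → ℝ) (y : P b → ℝ),
    (∀ j, (fun i => c j ⟨b, i⟩) ⬝ᵥ Sum.elim x y = 0) →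
      β * (Sum.elim x y ⬝ᵥ (Matrix.of fun i i' => G ⟨b, i⟩ ⟨b, i'⟩) *ᵥ Sum.elim x y) ≤
        Sum.elim x y ⬝ᵥ (Matrix.of fun i i' => M ⟨b, i⟩ ⟨b, i'⟩) *ᵥ Sum.elim x y

namespace EDSectorBlockCert

variable {L : ℕ} [NeZero L]
  {H : Matrix (Finset (Orb (FermionTorus 2 L))) (Finset (Orb (FermionTorus 2 L))) ℂ} {N : ℕ} {β : ℝ}
  {m : ℕ} {φ : Fin m → Fock (Orb (FermionTorus 2 L))}
  {B : Type} [Fintype B] [DecidableEq B] {F P : B → Type} [∀ b, Fintype (F b)] [∀ b, Fintype (P b)]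

/-- The global real certificate `β (y ⬝ G y) ≤ y ⬝ M y` on `{c_j ⬝ y = 0 ∀ j}` (block bookkeeping). -/
theorem form_ge (cert : EDSectorBlockCert L H N β φ B F P) (y : ((b : B) × (F b ⊕ P b)) → ℝ)
    (hy : ∀ j, cert.c j ⬝ᵥ y = 0) : β * (y ⬝ᵥ cert.G *ᵥ y) ≤ y ⬝ᵥ cert.M *ᵥ y :=
  form_ge_on_ker_of_sigma_sum_blocks cert.M cert.G β cert.c cert.M_blk cert.G_blk cert.c_blk cert.blk
    y hy

/-- **T7.3 — the `complement` field of `ResidualComplementMultipletData` from an E-D-2″ block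
certificate**: for every `v` in the sector orthogonal to the multiplet, `β ‖v‖² ≤ Re⟨v, H v⟩`; in
particular `β ≤ Re⟨v, Hv⟩` for unit `v`. [folklore] -/
theorem complement (cert : EDSectorBlockCert L H N β φ B F P) :
    ∀ v ∈ szSector (Λ := FermionTorus 2 L) N 0, (∀ i, star (φ i) ⬝ᵥ v = 0) →
      star v ⬝ᵥ v = 1 → β ≤ (star v ⬝ᵥ H *ᵥ v).re :=
  fun v hv horth h1 =>
    re_form_ge_on_orthogonal_of_real_frame_certificate_unit H (szSector (Λ := FermionTorus 2 L) N 0)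
      cert.Φ cert.spans cert.M cert.G cert.hM cert.hG φ cert.c cert.hc cert.form_ge v hv horth h1

end EDSectorBlockCert

/-- **Typed obligation T7.3 (soundness of the E-D-2″ complement step)**: every block certificate in a
block-ordered real frame of the `(N, S^z = 0)` sector yields the complement-gap field at its level `β`.
PROVED (`edSectorGlue_holds`). The R3 rows will instantiate it with `H = hubbardTorusTT' 4 1 t' 8`,
`N = 14`, `t' ∈ {0, −1/4}`; none exists yet. -/
@[conjecture] def EDSectorGlue : Prop :=
  ∀ (L : ℕ) [NeZero L]
    (H : Matrix (Finset (Orb (FermionTorus 2 L))) (Finset (Orb (FermionTorus 2 L))) ℂ) (N : ℕ) (β : ℝ)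
    (m : ℕ) (φ : Fin m → Fock (Orb (FermionTorus 2 L)))
    (B : Type) [Fintype B] [DecidableEq B] (F P : B → Type) [∀ b, Fintype (F b)] [∀ b, Fintype (P b)],
    EDSectorBlockCert L H N β φ B F P →
      ∀ v ∈ szSector (Λ := FermionTorus 2 L) N 0, (∀ i, star (φ i) ⬝ᵥ v = 0) →
        star v ⬝ᵥ v = 1 → β ≤ (star v ⬝ᵥ H *ᵥ v).re

/-- **Proof of `EDSectorGlue`.** -/
theorem edSectorGlue_holds : EDSectorGlue :=
  fun _ _ _ _ _ _ _ _ _ _ _ _ _ _ cert => cert.complement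

end Summit.HubbardSuperconductivity.HubbardLadder

end
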